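import Literature.NumberTheory.EllipticCurves.Kato2004.Condition1252
import Literature.NumberTheory.Automorphic.MatrixTwoConjugacy
import HarnessLib

/-!
# A Kato `σ` acts on `T_pE` as the standard transvection `(1 1; 0 1)` in an adapted basis

Route-free Theorems file of cell `bsd-potss` (namespace `…Theorems.KatoSigma`); THEOREMS ONLY (no
definition, no named fact; imports Literature only). Cell `bsd-potss`, seat `bsd-potss-k9-c4` g13 (prover; node
`WildUpperNonsurjTower` 19189 of item 19197, route `KatoDescentPotSupersingular`, rung K9). Part 1 of
2; part 2 is `Theorems/KatoDescentPotSupersingularKatoSigmaNineOnto.lean` (at `p = 3` a Kato `σ` forces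
`ρ̄_{E,9}` onto; Kato's 13.4 (3) hypothesis ⟺ (12.5.2) for `T_pE`, `p` odd). Nothing is booked;
BSD is proved for no curve.

K. Kato, *Astérisque* 295 (2004), Thm. 13.4 (3) (p. 226) asks for "an element `σ` of
`Gal(ℚ̄/ℚ(ζ_{p^∞}))` such that `Coker(1 − σ : T → T)` is a free `O_L`-module of rank `1`"
(= hypothesis (im) of Burungale–Castella–Skinner, IMRN 2025, and Skinner 2016 §2.5 (b)); the
tree spells it `∃ σ, (∀ n t, t ^ p ^ n = 1 → σ • t = t) ∧ Nonempty ((T_pW ⧸ range (ρ σ − 1)) ≃ₗ[ℤ_p] ℤ_p)`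
(`Kato2004.fineSelmer_eulerSystemBound` clause (3); `Kato2004.exists_quotient_range_sub_one_equiv_of_imageContainsSL2`).

**Theorem** (`KatoSigma.exists_basis_toMatrix_galoisRepTate_eq_transvection`, any prime
`p`, any elliptic curve `E = W/ℚ`). If `σ ∈ Γ_ℚ` fixes every `p`-power root of unity and
`T_pE/(ρ_{E,p}(σ) − 1)T_pE ≃ ℤ_p`, then in some `ℤ_p`-basis of `T_pE` the matrix of `ρ_{E,p}(σ)` is
`(1 1; 0 1)`.  Proof: `det ρ(σ) = χ_p(σ) = 1` (Weil pairing, `det_galoisRepTate_eq_cyclotomicCharacter`;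
`cyclotomicCharacter_eq_one_of_forall_pow_eq_one`); the element `det(ρ(σ) − 1)` kills the cokernel
(adjugate identity), which is `≃ ℤ_p`, so `det(ρ(σ) − 1) = 0`, whence `tr ρ(σ) = 2` and
`(ρ(σ) − 1)² = 0` (Cayley–Hamilton for `2 × 2` matrices); with `ψ : T_pE → ℤ_p` the quotient map,
`e₂` with `ψ(e₂) = 1` and `e₁ := (ρ(σ) − 1)e₂`: every `x` equals `ψ(y)e₁ + ψ(x)e₂`, `e₁ ≠ 0` (else
`ψ` is an isomorphism `T_pE ≃ ℤ_p`, contradicting rank `2`), `{e₁, e₂}` is linearly independent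
(apply `ψ`; `T_pE` is torsion free), and `ρ(σ)e₁ = e₁`, `ρ(σ)e₂ = e₁ + e₂`.  This is the converse
direction of the tree's `σ ↦ (1 1; 0 1)` construction
(`exists_quotient_range_galoisRepTate_sub_one_equiv_of_forall_surjective`).

## References

* [Kato2004Asterisque] K. Kato, Astérisque 295 (2004), Thm. 13.4 (3) (p. 226); (12.5.2) in
  Thm. 12.5 (4) (p. 222).
* [BurungaleCastellaSkinner2025] A. Burungale, F. Castella, C. Skinner, IMRN 2025 =
  arXiv:2405.00270v2, hypothesis (im), Rem. 1.1.3 (iii).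
* [SilvermanAEC2009] J. H. Silverman, *AEC* 2nd ed., III.§7–§8 (`T_ℓE`, Weil pairing).
-/

set_option autoImplicit false
-- the Theorems directory repeats the summit name (sibling precedent `KatoDescentPotSupersingularAssembly.lean`)
set_option linter.dupNamespace false

noncomputable section

open scoped Classical
open Field

namespace Summit.BirchSwinnertonDyer.BirchSwinnertonDyer.Theorems.KatoSigma

open Literature.NumberTheory.EllipticCurves Literature.NumberTheory.GaloisRepresentations WeierstrassCurve

/-! ### Elementary lemmas (`2 × 2` matrices; units and multiples of `3` in `ℤ₃`), shared with part 2 -/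

section Elementary

variable {R : Type*} [CommRing R]

/-- `det (X − 1) = det X − tr X + 1` for a `2 × 2` matrix. [folklore] -/
theorem mat_det_sub_one (X : Matrix (Fin 2) (Fin 2) R) :
    (X - 1).det = X.det - X.trace + 1 := by
  simp [Matrix.det_fin_two, Matrix.trace_fin_two]
  ring

/-- `SL₂(𝔽₃) = Q₈ ⋊ C₃` on entries: for `(a b; c d) ∈ SL₂(𝔽₃)` some `j ∈ 𝔽₃` makes
`(a b; c d)(1 j; 0 1)` traceless (`c ≠ 0`) or the scalar `a = ±1` (`c = 0`). [folklore] -/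
theorem zmod3_sl2_cases : ∀ a b c d : ZMod 3, a * d - b * c = 1 →
    ∃ j : ZMod 3, (c ≠ 0 ∧ a + d + j * c = 0) ∨ (c = 0 ∧ d = a ∧ a * a = 1 ∧ b + j * a = 0) := by
  decide

/-- `(1 + E)^k = 1 + k E`. [folklore] -/
theorem one_add_matE_pow (k : ℕ) :
    ((1 : Matrix (Fin 2) (Fin 2) R) + !![0, 1; 0, 0]) ^ k = 1 + (k : R) • !![0, 1; 0, 0] := by
  induction k with
  | zero => simp
  | succ k ih =>
    rw [pow_succ, ih]
    ext i j
    fin_cases i <;> fin_cases j <;> simp [Matrix.mul_apply, Fin.sum_univ_two]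
    ring

/-- `det (1 + a M) = 1 + a tr M + a² det M` for a `2 × 2` matrix. [folklore] -/
theorem mat_det_one_add_smul (a : R) (M : Matrix (Fin 2) (Fin 2) R) :
    (1 + a • M).det = 1 + a * M.trace + a ^ 2 * M.det := by
  simp [Matrix.det_fin_two, Matrix.trace_fin_two]
  ring

/-- `(1 + aM)(1 + aN) = 1 + a(M + N) + a²(MN)`. [folklore] -/
theorem mat_one_add_smul_mul_one_add_smul (a : R) (M N : Matrix (Fin 2) (Fin 2) R) :
    (1 + a • M) * (1 + a • N) = 1 + a • (M + N) + a ^ 2 • (M * N) := by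
  simp only [add_mul, one_mul, mul_add, mul_one, smul_add, Matrix.smul_mul, Matrix.mul_smul,
    smul_smul, pow_two]
  abel

/-- Matrices of powers of an endomorphism. [folklore] -/
theorem toMatrix_pow_eq {S M' : Type*} [CommRing S] [AddCommGroup M'] [Module S M']
    (b : Module.Basis (Fin 2) S M') (f : M' →ₗ[S] M') (k : ℕ) :
    LinearMap.toMatrix b b (f ^ k) = (LinearMap.toMatrix b b f) ^ k := by
  induction k with
  | zero => rw [pow_zero, pow_zero, LinearMap.toMatrix_one]
  | succ k ih => rw [pow_succ, pow_succ, LinearMap.toMatrix_mul, ih]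

/-- A traceless `2 × 2` matrix of determinant `1` has fourth power `1` (`X² = -1`). [folklore] -/
theorem mat_pow_four_of_trace_zero_of_det_one (X : Matrix (Fin 2) (Fin 2) R)
    (htr : X.trace = 0) (hdet : X.det = 1) : X ^ 4 = 1 := by
  have h2 : X * X = -1 := by
    rw [Literature.NumberTheory.Automorphic.matrixTwo_mul_self, htr, hdet, zero_smul, one_smul,
      zero_sub]
  rw [show (4 : ℕ) = 2 + 2 by rfl, pow_add, pow_two, h2]
  simp

/-- `(1 + 3·)` is a unit of `ℤ₃`. [folklore] -/
theorem isUnit_one_add_three_mul (z : ℤ_[3]) : IsUnit (1 + 3 * z) := by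
  have hmem : -((3 : ℤ_[3]) * z) ∈ nonunits ℤ_[3] := by
    rw [PadicInt.mem_nonunits, norm_neg, norm_mul]
    have h3 : ‖(3 : ℤ_[3])‖ = (3 : ℝ)⁻¹ := by
      have := PadicInt.norm_p (p := 3)
      simpa using this
    rw [h3]
    have hz : ‖z‖ ≤ 1 := PadicInt.norm_le_one z
    nlinarith [norm_nonneg z]
  have h := IsLocalRing.isUnit_one_sub_self_of_mem_nonunits _ hmem
  rwa [sub_neg_eq_add] at h

/-- A non-unit of `ℤ₃` is `3 ·` something. [folklore] -/
theorem exists_eq_three_mul_of_not_isUnit {z : ℤ_[3]} (hz : ¬ IsUnit z) : ∃ y, z = 3 * y := by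
  haveI : Fact (Nat.Prime 3) := ⟨Nat.prime_three⟩
  rw [PadicInt.isUnit_iff] at hz
  have h := (PadicInt.norm_lt_one_iff_dvd z).mp (lt_of_le_of_ne (PadicInt.norm_le_one z) hz)
  obtain ⟨y, hy⟩ := h
  exact ⟨y, by simpa using hy⟩

/-- An element of `ℤ₃` with residue `0` is `3 ·` something. [folklore] -/
theorem exists_eq_three_mul_of_toZMod_eq_zero {z : ℤ_[3]}
    (hz : PadicInt.toZMod (p := 3) z = 0) : ∃ y, z = 3 * y := by
  haveI : Fact (Nat.Prime 3) := ⟨Nat.prime_three⟩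
  have hmem : z ∈ RingHom.ker (PadicInt.toZMod (p := 3)) := hz
  rw [PadicInt.ker_toZMod, PadicInt.maximalIdeal_eq_span_p, Ideal.mem_span_singleton] at hmem
  obtain ⟨y, hy⟩ := hmem
  exact ⟨y, by simpa using hy⟩

end Elementary

variable (W : WeierstrassCurve ℚ) [W.IsElliptic] (p : ℕ) [Fact p.Prime]

/-- **A Kato `σ` is the standard transvection in an adapted basis.**  Let `E = W/ℚ` be an elliptic
curve, `p` a prime, `σ ∈ Γ_ℚ` an element fixing every `p`-power root of unity
(`σ ∈ Gal(ℚ̄/ℚ(ζ_{p^∞}))`) such that the cokernel of `ρ_{E,p}(σ) − 1` on the Tate module `T_pE` is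
isomorphic to `ℤ_p` (Kato's hypothesis of Thm. 13.4 (3); hypothesis (im) of
Burungale–Castella–Skinner 2025). Then in some `ℤ_p`-basis of `T_pE` the matrix of `ρ_{E,p}(σ)` is
`(1 1; 0 1)`.  Proof: `det ρ(σ) = χ_p(σ) = 1` (Weil pairing); `det(ρ(σ) − 1)` kills the cokernel
`≃ ℤ_p` (adjugate), so it is `0`, whence `tr ρ(σ) = 2` and `(ρ(σ) − 1)² = 0` (Cayley–Hamilton); with
`ψ : T_pE → ℤ_p` the quotient map, `e₂` with `ψ e₂ = 1` and `e₁ = (ρ(σ) − 1)e₂`, every `x` is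
`ψ(y)e₁ + ψ(x)e₂`, `e₁ ≠ 0` (else `T_pE ≃ ℤ_p`, rank `2`), and `{e₁, e₂}` is the basis.
[cite: Kato2004Asterisque, Thm. 13.4 (3) (p. 226) and (12.5.2) in Thm. 12.5 (4) (p. 222)]
[cite: BurungaleCastellaSkinner2025, hypothesis (im) and Rem. 1.1.3 (iii)] -/
theorem exists_basis_toMatrix_galoisRepTate_eq_transvection (σ : absoluteGaloisGroup ℚ)
    (hσ : ∀ (n : ℕ) (t : AlgebraicClosure ℚ), t ^ p ^ n = 1 → σ • t = t)
    (Ψ : ((W.tateModule p) ⧸ LinearMap.range (W.galoisRepTate p σ - 1)) ≃ₗ[ℤ_[p]] ℤ_[p]) :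
    ∃ b : Module.Basis (Fin 2) ℤ_[p] (W.tateModule p),
      LinearMap.toMatrix b b (W.galoisRepTate p σ) = !![1, 1; 0, 1] := by
  have hp : p.Prime := Fact.out
  have hp0 : (p : ℚ) ≠ 0 := Nat.cast_ne_zero.mpr hp.ne_zero
  haveI : Module.Free ℤ_[p] (W.tateModule p) := module_free_tateModule_holds W p
  haveI : Module.Finite ℤ_[p] (W.tateModule p) := module_finite_tateModule_holds W p
  set T := W.tateModule p
  set u : T →ₗ[ℤ_[p]] T := W.galoisRepTate p σ with hu
  set N : T →ₗ[ℤ_[p]] T := u - 1 with hN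
  have huN : u = N + 1 := by rw [hN, sub_add_cancel]
  -- the functional `ψ : T → ℤ_p` with kernel `range N`
  set ψ : T →ₗ[ℤ_[p]] ℤ_[p] := Ψ.toLinearMap ∘ₗ (LinearMap.range N).mkQ with hψ
  have hψsurj : Function.Surjective ψ := Ψ.surjective.comp (Submodule.mkQ_surjective _)
  have hψker : ∀ x, ψ x = 0 ↔ x ∈ LinearMap.range N := by
    intro x
    rw [hψ, LinearMap.comp_apply, LinearEquiv.coe_coe, LinearEquiv.map_eq_zero_iff,
      Submodule.mkQ_apply, Submodule.Quotient.mk_eq_zero]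
  -- `det u = 1` (the cyclotomic character of `σ` is `1`)
  have hχ : GaloisRep.cyclotomicCharacter ℚ p σ = 1 := by
    rw [GaloisRep.cyclotomicCharacter_apply]
    exact cyclotomicCharacter_eq_one_of_forall_pow_eq_one p _ fun n t ht => hσ n t ht
  have hdetu : LinearMap.det u = 1 := by
    rw [hu, det_galoisRepTate_eq_cyclotomicCharacter W p hp0 (fun n => exists_weilPairing_holds W _) σ,
      hχ, Units.val_one]
  -- an auxiliary basis
  let b' : Module.Basis (Fin 2) ℤ_[p] T :=
    Module.finBasisOfFinrankEq ℤ_[p] T (finrank_tateModule_eq_two_holds W p hp0)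
  -- `det N = 0`: `det N` kills the quotient `T / range N ≅ ℤ_p`
  have hdetN : LinearMap.det N = 0 := by
    set A := LinearMap.toMatrix b' b' N with hA
    have hadj : ∀ x : T, (LinearMap.det N) • x ∈ LinearMap.range N := by
      intro x
      refine ⟨Matrix.toLin b' b' A.adjugate x, ?_⟩
      have h1 : N ∘ₗ Matrix.toLin b' b' A.adjugate = (LinearMap.det N) • LinearMap.id := by
        apply (LinearMap.toMatrix b' b').injective
        rw [LinearMap.toMatrix_comp b' b' b', LinearMap.toMatrix_toLin, ← hA, Matrix.mul_adjugate,
          map_smul, LinearMap.toMatrix_id, hA, LinearMap.det_toMatrix]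
      have h2 := LinearMap.congr_fun h1 x
      rw [LinearMap.comp_apply, LinearMap.smul_apply, LinearMap.id_apply] at h2
      exact h2
    obtain ⟨x1, hx1⟩ := hψsurj 1
    have h2 : ψ ((LinearMap.det N) • x1) = 0 := (hψker _).mpr (hadj x1)
    rwa [map_smul, hx1, smul_eq_mul, mul_one] at h2
  -- `N ∘ N = 0` (Cayley–Hamilton: `tr u = 2`, `det u = 1`)
  have hN2 : N * N = 0 := by
    apply (LinearMap.toMatrix b' b').injective
    set U := LinearMap.toMatrix b' b' u with hU
    have hNU : LinearMap.toMatrix b' b' N = U - 1 := by rw [hN, map_sub, LinearMap.toMatrix_one]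
    have hdetU : U.det = 1 := by rw [hU, LinearMap.det_toMatrix, hdetu]
    have htrU : U.trace = 2 := by
      have h1 : (U - 1).det = 0 := by rw [← hNU, LinearMap.det_toMatrix, hdetN]
      rw [mat_det_sub_one, hdetU] at h1
      linear_combination -h1
    rw [LinearMap.toMatrix_mul, hNU, map_zero]
    have hsq := Literature.NumberTheory.Automorphic.matrixTwo_mul_self U
    rw [htrU, hdetU, one_smul] at hsq
    rw [sub_mul, mul_sub, one_mul, mul_one, hsq]
    ext i j
    simp [Matrix.sub_apply, Matrix.smul_apply]
    ring
  have hNN : ∀ x : T, N (N x) = 0 := fun x => by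
    have := LinearMap.congr_fun hN2 x
    rwa [Module.End.mul_apply, LinearMap.zero_apply] at this
  -- the adapted basis `e₁ = N e₂`, `ψ e₂ = 1`
  obtain ⟨e₂, he₂⟩ := hψsurj 1
  set e₁ := N e₂ with he₁
  have hNe₁ : N e₁ = 0 := hNN e₂
  have hψe₁ : ψ e₁ = 0 := (hψker _).mpr ⟨e₂, rfl⟩
  have hdec : ∀ x : T, ∃ c : ℤ_[p], x = c • e₁ + ψ x • e₂ := by
    intro x
    have hx : x - ψ x • e₂ ∈ LinearMap.range N := by
      rw [← hψker, map_sub, map_smul, he₂, smul_eq_mul, mul_one, sub_self]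
    obtain ⟨y, hy⟩ := hx
    have hy2 : y - ψ y • e₂ ∈ LinearMap.range N := by
      rw [← hψker, map_sub, map_smul, he₂, smul_eq_mul, mul_one, sub_self]
    obtain ⟨y', hy'⟩ := hy2
    refine ⟨ψ y, ?_⟩
    have h1 : N y = ψ y • e₁ := by
      have hyy : y = ψ y • e₂ + N y' := by rw [hy']; abel
      have h4 := congrArg N hyy
      rw [map_add, map_smul, hNN, add_zero] at h4
      exact h4
    rw [← h1, hy]
    abel
  have he₁0 : e₁ ≠ 0 := by
    intro h0
    have hN0 : ∀ x : T, N x = 0 := by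
      intro x
      obtain ⟨c, hc⟩ := hdec x
      rw [hc, map_add, map_smul, map_smul, hNe₁, smul_zero, zero_add, ← he₁, h0, smul_zero]
    have hinj : Function.Injective ψ := by
      intro x y hxy
      have h3 : ψ (x - y) = 0 := by rw [map_sub, hxy, sub_self]
      obtain ⟨z, hz⟩ := (hψker _).mp h3
      rw [hN0] at hz
      exact (sub_eq_zero.mp hz.symm).symm ▸ rfl
    have e : T ≃ₗ[ℤ_[p]] ℤ_[p] := LinearEquiv.ofBijective ψ ⟨hinj, hψsurj⟩
    have h2 : Module.finrank ℤ_[p] T = 2 := finrank_tateModule_eq_two_holds W p hp0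
    rw [e.finrank_eq, Module.finrank_self] at h2
    exact absurd h2 (by norm_num)
  have hli : LinearIndependent ℤ_[p] ![e₁, e₂] := by
    refine LinearIndependent.pair_iff.mpr fun s t hst => ?_
    have ht : t = 0 := by
      have h3 := congrArg ψ hst
      rw [map_add, map_smul, map_smul, hψe₁, he₂, smul_zero, zero_add, smul_eq_mul, mul_one,
        map_zero] at h3
      exact h3
    subst ht
    rw [zero_smul, add_zero] at hst
    exact ⟨(smul_eq_zero.mp hst).resolve_right he₁0, rfl⟩
  have hsp : ⊤ ≤ Submodule.span ℤ_[p] (Set.range ![e₁, e₂]) := by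
    rintro x -
    obtain ⟨c, hc⟩ := hdec x
    rw [hc]
    exact Submodule.add_mem _
      (Submodule.smul_mem _ _ (Submodule.subset_span ⟨0, by simp⟩))
      (Submodule.smul_mem _ _ (Submodule.subset_span ⟨1, by simp⟩))
  let b : Module.Basis (Fin 2) ℤ_[p] T := Module.Basis.mk hli hsp
  have hb0 : b 0 = e₁ := by rw [Module.Basis.mk_apply]; rfl
  have hb1 : b 1 = e₂ := by rw [Module.Basis.mk_apply]; rfl
  refine ⟨b, ?_⟩
  have hu0 : u (b 0) = b 0 := by
    rw [hb0, huN, LinearMap.add_apply, hNe₁, zero_add, Module.End.one_apply]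
  have hu1 : u (b 1) = b 0 + b 1 := by
    rw [hb1, hb0, huN, LinearMap.add_apply, Module.End.one_apply]
  ext i j
  rw [LinearMap.toMatrix_apply]
  fin_cases j
  · simp only [Fin.zero_eta, hu0, Module.Basis.repr_self]
    fin_cases i <;> simp
  · simp only [Fin.mk_one, hu1, map_add, Module.Basis.repr_self, Finsupp.add_apply]
    fin_cases i <;> simp

end Summit.BirchSwinnertonDyer.BirchSwinnertonDyer.Theorems.KatoSigma

end
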